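import Literature.Analysis.FluidPDE.CompressibleEulerImplosionCoreCertificate
import Literature.Analysis.FluidPDE.CompressibleEulerImplosionCentreSeriesCalculus
import Mathlib.Analysis.Complex.ExponentialBounds
import HarnessLib

/-!
# Buckmaster–Cao-Labora–Gómez-Serrano at `γ = 5/3`: the certified core envelope of the series profile on `x ≤ −1/3`

Companion of `…CoreCertificate` (the sixteen kernel-certified sign conditions of clauses (b), (c) of the cavity tube
of the crux `DenseExcursion`, line `sonic-cavity-renewal`, for `ζ = c eˣ ∈ [27c/200, 7169c/10000]`, i.e.
`x ∈ [−2, −1/3]`), `…CentreSeriesCalculus` (the series profile and its derivatives as `fW r m ζ`, `fU r m ζ`) and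
`…CentreExpansionWindow2` (the certified second-order centre expansion (d), which controls everything on `x ≤ −2`,
where `e^{2x} ≤ 1/53`). Main theorem `core_envelope_window2`: for every `r` in the shooting window, every sonic scale
`c ∈ [17/50, 23/50]` and every `x ≤ −1/3`, the series profile `(Wser r c, Sser r c)` satisfies the radial and angular
repulsivity bounds (b) (`1 − W − W′ − |S + S′| ≥ 3/8`, `1 − W − |S + S′| ≥ 5/8`) and the `C²` envelope (c)
(`|W| ≤ 1/4`, `|W′| ≤ 1/2`, `|W″| ≤ 6`, `7/10 ≤ eˣS ≤ 1`, `|(eˣS)′| ≤ 1/4`, `|(eˣS)″| ≤ 2`) of the cavity tube.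
No facts, no axioms.

[cite: BuckmasterCaolaboraGomezserrano2025, Prop. 2.5, App. B]
-/

noncomputable section

open Filter Topology

namespace Literature.Analysis.FluidPDE

namespace BuckmasterCaolaboraGomezserrano2025

namespace OriginSeries

namespace CentreW2

set_option linter.style.longLine false
set_option linter.style.setOption false
set_option maxHeartbeats 1600000

/-! ### Numerical constants -/

/-- `27/200 ≤ e^{−2}`. [folklore] -/
theorem exp_neg_two_ge : (27 / 200 : ℝ) ≤ Real.exp (-2) := by
  have h1 := Real.exp_one_lt_d9
  have h0 := Real.exp_pos (1 : ℝ)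
  have h2 : Real.exp 2 < 200 / 27 := by
    rw [show (2 : ℝ) = 1 + 1 by norm_num, Real.exp_add]; nlinarith
  rw [Real.exp_neg, le_inv_comm₀ (by norm_num) (Real.exp_pos _)]
  linarith

/-- `e^{−2} ≤ 1354/10000`. [folklore] -/
theorem exp_neg_two_le : Real.exp (-2) ≤ 1354 / 10000 := by
  have h1 := Real.exp_one_gt_d9
  have h2 : (10000 / 1354 : ℝ) < Real.exp 2 := by
    rw [show (2 : ℝ) = 1 + 1 by norm_num, Real.exp_add]; nlinarith
  rw [Real.exp_neg, inv_le_comm₀ (Real.exp_pos _) (by norm_num)]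
  linarith

/-! ### The series `eˣS` and its derivatives -/

variable {r c x : ℝ} (hr : r ∈ Set.Icc ((13890041/12500000 : ℚ) : ℝ) ((697/625 : ℚ) : ℝ)) (hc : 0 < c)
  (hx : (73 / 25 : ℝ) * (c * Real.exp x) < 1)

include hc in
/-- `eˣ·Sser r c x = fU r 0 ζ / c`. [cite: BuckmasterCaolaboraGomezserrano2025, Prop. 2.5] -/
theorem expS_eq : Real.exp x * Sser r c x = fU r 0 (c * Real.exp x) / c := by
  rw [Sser_eq_fU hc]
  have hex : Real.exp x ≠ 0 := (Real.exp_pos x).ne'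
  field_simp

include hr hc hx in
/-- `(eˣS)′ x = fU r 1 ζ / c`. [cite: BuckmasterCaolaboraGomezserrano2025, Prop. 2.5] -/
theorem deriv_expS_eq : deriv (fun y => Real.exp y * Sser r c y) x = fU r 1 (c * Real.exp x) / c := by
  rw [exp_mul_Sser]; exact (hasDerivAt_T hr hc hx).deriv

include hr hc hx in
/-- `(eˣS)″ x = fU r 2 ζ / c`. [cite: BuckmasterCaolaboraGomezserrano2025, Prop. 2.5] -/
theorem deriv2_expS_eq : deriv (deriv (fun y => Real.exp y * Sser r c y)) x = fU r 2 (c * Real.exp x) / c := by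
  rw [exp_mul_Sser]
  have hev : xSeries (fun k : ℕ => (k : ℝ) * aS r c k) c =ᶠ[𝓝 x] deriv (xSeries (aS r c) c) := by
    filter_upwards [(isOpen_disc c).mem_nhds hx] with y hy
    exact (deriv_xSeries_eq (aS_bound hr hc) (by norm_num) hc hy).symm
  exact ((hasDerivAt_T1 hr hc hx).congr_of_eventuallyEq hev.symm).deriv

/-! ### The main theorem -/

/-- If `|a| ≤ A` and `0 ≤ s` then `|a s| ≤ A s`. [folklore] -/
theorem abs_mul_le_of_abs_le {a A s : ℝ} (ha : |a| ≤ A) (hs : 0 ≤ s) : |a * s| ≤ A * s := by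
  rw [abs_mul, abs_of_nonneg hs]; exact mul_le_mul_of_nonneg_right ha hs

/-- **The certified core envelope on `x ≤ −1/3`** (clauses (b) and (c) of the cavity tube of the crux `DenseExcursion`
for the series profile, uniformly in `r ∈ [13890041/12500000, 697/625]` and `c ∈ [17/50, 23/50]`).
[cite: BuckmasterCaolaboraGomezserrano2025, Prop. 2.5, App. B] -/
theorem core_envelope_window2 {r c : ℝ} (hr : r ∈ Set.Icc ((13890041/12500000 : ℚ) : ℝ) ((697/625 : ℚ) : ℝ))
    (hc : c ∈ Set.Icc (17 / 50 : ℝ) (23 / 50)) : ∀ x : ℝ, x ≤ -(1 / 3) →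
    3 / 8 ≤ 1 - Wser r c x - deriv (Wser r c) x - |Sser r c x + deriv (Sser r c) x| ∧
    5 / 8 ≤ 1 - Wser r c x - |Sser r c x + deriv (Sser r c) x| ∧
    (|Wser r c x| ≤ 1 / 4 ∧ |deriv (Wser r c) x| ≤ 1 / 2 ∧ |deriv (deriv (Wser r c)) x| ≤ 6) ∧
    (7 / 10 ≤ Real.exp x * Sser r c x ∧ Real.exp x * Sser r c x ≤ 1 ∧
      |deriv (fun y => Real.exp y * Sser r c y) x| ≤ 1 / 4 ∧ |deriv (deriv (fun y => Real.exp y * Sser r c y)) x| ≤ 2) := by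
  intro x hx
  obtain ⟨hc1, hc2⟩ := hc
  have hc0 : 0 < c := by linarith
  have ht0 : 0 < Real.exp x := Real.exp_pos x
  have ht1 : Real.exp x ≤ 7169 / 10000 := (Real.exp_le_exp.mpr hx).trans exp_neg_third_le
  have hz : 0 < c * Real.exp x := by positivity
  have hct : c * Real.exp x ≤ 23 / 50 * (7169 / 10000) := mul_le_mul hc2 ht1 ht0.le (by norm_num)
  have hdisc : (73 / 25 : ℝ) * (c * Real.exp x) < 1 := by linarith
  have eS := Sser_eq_fU hc0 r x
  have edS := deriv_Sser_eq hr hc0 hdisc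
  have edT := deriv_expS_eq hr hc0 hdisc
  rcases le_or_gt x (-2) with hA | hB
  · -- CASE `x ≤ −2`: everything from the centre expansion (d)
    have ht2 : Real.exp x ≤ 1354 / 10000 := (Real.exp_le_exp.mpr hA).trans exp_neg_two_le
    have htt : Real.exp x ^ 2 ≤ 1834 / 100000 := (pow_le_pow_left₀ ht0.le ht2 2).trans (by norm_num)
    have ht3 : Real.exp x ^ 3 ≤ 249 / 100000 := (pow_le_pow_left₀ ht0.le ht2 3).trans (by norm_num)
    have ht4 : Real.exp x ^ 4 ≤ 34 / 100000 := (pow_le_pow_left₀ ht0.le ht2 4).trans (by norm_num)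
    have e2 : Real.exp (2 * x) = Real.exp x ^ 2 := by rw [← Real.exp_nat_mul]; norm_num
    have e4 : Real.exp (4 * x) = Real.exp x ^ 4 := by rw [← Real.exp_nat_mul]; norm_num
    have hs0l : (50 / 69 : ℝ) ≤ 1 / (3 * c) := by rw [div_le_div_iff₀ (by norm_num) (by positivity)]; linarith
    have hs0u : 1 / (3 * c) ≤ 50 / 51 := by rw [div_le_div_iff₀ (by positivity) (by norm_num)]; linarith
    have hr1 : (13890041 / 12500000 : ℝ) ≤ r := by have := hr.1; push_cast at this; exact this
    have hr2 : r ≤ 697 / 625 := by have := hr.2; push_cast at this; exact this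
    obtain ⟨hW2b, -, -, hs2b, hsix⟩ := centre_expansion_window2 hr (c := c) ⟨by linarith, by linarith⟩
    obtain ⟨d1, d2, d3, d4, d5, d6⟩ := hsix x hx
    rw [e2, e4] at d1 d2 d3 d4 d5 d6
    have ht20 : 0 ≤ Real.exp x ^ 2 := by positivity
    obtain ⟨u1, u2⟩ := abs_le.mp (abs_mul_le_of_abs_le hW2b ht20)
    obtain ⟨v1, v2⟩ := abs_le.mp (abs_mul_le_of_abs_le hs2b ht20)
    obtain ⟨d1l, d1u⟩ := abs_le.mp d1
    obtain ⟨d2l, d2u⟩ := abs_le.mp d2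
    obtain ⟨d3l, d3u⟩ := abs_le.mp d3
    obtain ⟨d4l, d4u⟩ := abs_le.mp d4
    obtain ⟨d5l, d5u⟩ := abs_le.mp d5
    obtain ⟨d6l, d6u⟩ := abs_le.mp d6
    -- the derivative of `eˣS` controls `S + S′ = e^{-x} (eˣS)′`
    have eSS : Sser r c x + deriv (Sser r c) x = deriv (fun y => Real.exp y * Sser r c y) x / Real.exp x := by
      rw [eS, edS, edT]; field_simp; ring
    have hSS : |Sser r c x + deriv (Sser r c) x| ≤ Real.exp x / 5 + 2 * Real.exp x ^ 3 := by
      rw [eSS, abs_div, abs_of_pos ht0, div_le_iff₀ ht0]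
      have e : (Real.exp x / 5 + 2 * Real.exp x ^ 3) * Real.exp x = Real.exp x ^ 2 / 5 + 2 * Real.exp x ^ 4 := by ring
      rw [e, abs_le]; constructor <;> linarith
    have hSS' := neg_abs_le (Sser r c x + deriv (Sser r c) x)
    refine ⟨by linarith, by linarith, ⟨abs_le.mpr ⟨by linarith, by linarith⟩, abs_le.mpr ⟨by linarith, by linarith⟩,
      abs_le.mpr ⟨by linarith, by linarith⟩⟩, by linarith, by linarith, abs_le.mpr ⟨by linarith, by linarith⟩,
      abs_le.mpr ⟨by linarith, by linarith⟩⟩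
  · -- CASE `−2 < x ≤ −1/3`: the kernel certificate
    have ht2 : 27 / 200 ≤ Real.exp x := exp_neg_two_ge.trans (Real.exp_le_exp.mpr hB.le)
    have h1 : 27 * c / 200 ≤ c * Real.exp x := by
      have := mul_le_mul_of_nonneg_left ht2 hc0.le; linarith
    have h2 : c * Real.exp x ≤ 7169 * c / 10000 := by
      have := mul_le_mul_of_nonneg_left ht1 hc0.le; linarith
    obtain ⟨k1, k2, k3, k4, k5, k6, k7, k8, k9, k10, k11, k12, k13, k14, k15, k16⟩ := core_pos_window2 hr ⟨hc1, hc2⟩ h1 h2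
    have eSS : Sser r c x + deriv (Sser r c) x = fU r 1 (c * Real.exp x) / (c * Real.exp x) := by
      rw [eS, edS]; field_simp; ring
    rw [eSS, Wser_eq_fW r c x, deriv_Wser_eq hr hc0 hdisc, deriv2_Wser_eq hr hc0 hdisc, expS_eq (r := r) (x := x) hc0, edT,
      deriv2_expS_eq hr hc0 hdisc, abs_div, abs_of_pos hz, abs_div (fU r 1 (c * Real.exp x)), abs_of_pos hc0,
      abs_div (fU r 2 (c * Real.exp x)), abs_of_pos hc0]
    have hU1 : |fU r 1 (c * Real.exp x)| / (c * Real.exp x) ≤ 5 / 8 - fW r 0 (c * Real.exp x) - fW r 1 (c * Real.exp x) := by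
      rw [div_le_iff₀ hz]; exact abs_le.mpr ⟨by linarith, by linarith⟩
    have hU1' : |fU r 1 (c * Real.exp x)| / (c * Real.exp x) ≤ 3 / 8 - fW r 0 (c * Real.exp x) := by
      rw [div_le_iff₀ hz]; exact abs_le.mpr ⟨by linarith, by linarith⟩
    refine ⟨by linarith, by linarith, ⟨abs_le.mpr ⟨by linarith, by linarith⟩, abs_le.mpr ⟨by linarith, by linarith⟩,
      abs_le.mpr ⟨by linarith, by linarith⟩⟩, ?_, ?_, ?_, ?_⟩
    · rw [le_div_iff₀ hc0]; linarith
    · rw [div_le_iff₀ hc0]; linarith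
    · rw [div_le_iff₀ hc0]; exact abs_le.mpr ⟨by linarith, by linarith⟩
    · rw [div_le_iff₀ hc0]; exact abs_le.mpr ⟨by linarith, by linarith⟩

end CentreW2

end OriginSeries

end BuckmasterCaolaboraGomezserrano2025

end Literature.Analysis.FluidPDE
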